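import Summits.CriticalPhenomena.Ising3DConformalLimit.Theorems.PrecisionLaplacianDirectCorrelationStableTailSlabModeExpDecayDiagLineHolAux3
import Summits.CriticalPhenomena.Ising3DConformalLimit.Theorems.PrecisionLaplacianDirectCorrelationStableTailPickInversionAux2

/-!
# Diagonal line holomorphy, auxiliary file 4: the two-slab Green forms along the diagonal as integrals
# of the diagonal line transforms

Helper file for the sub-stub `stub_slabModeExpDecay_auxDiagLineHol` (brick of `stub_slabModeExpDecay`)
of line `self-energy-pick-inversion`, crux `PrecisionLaplacian.DirectCorrelationStableTail`
(stmt-CriticalPhenomena-4799). Pure theorem file.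

With the diagonal line function `γ_k(θ) = g(θ + k₀/2, θ - k₀/2, k₁)` of file 3 (an even `2π`-periodic
function of `θ` when the step law is invariant under `x ↦ (x₁, x₀, -x₂)`) and its transforms
`c_{2n}(k) = ∫_{-π}^{π} cos(2nθ) γ_k(θ) dθ`, `ẽ_n(k) = ∫_{-π}^{π} cos(2nθ) cos θ γ_k(θ) dθ`:

* `ae_good_momentum`, `integrableOn_lineTransform_zero`, `integrableOn_lineTransform` : almost every
  transverse momentum is off `(2πℤ)²`; the line transforms are integrable over `[-π,π]²`;
* `twoSlab_form_eq_integral` (registered sub-goal `stub_slabModeExpDecay_auxDiagLineHol5`): for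
  weights `v` on the diagonal plane `{x_a = (a₀,-a₀,a₁)}` and `w` on the first odd layer `{e₀ - x_a}`,
  `(2π)³ [∑ (v_a v_b + w_a w_b) G(x_a - x_b + nu) + ∑ w_a v_b G(e₀ - x_a - x_b + nu) + ∑ v_a w_b G(x_a + x_b - e₀ + nu)]
   = ∫_{[-π,π]²} [c_{2n}(k) ∑ (v_a v_b + w_a w_b) cos(k·(a-b)) + ẽ_n(k) ∑ (w_a v_b + v_a w_b) cos(k₀/2 - k·(a+b))] dk`
  (`u = e₀ + e₁`; Green forms as slab integrals for the sheared step law `q ∘ σ` of file 3, with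
  sites `(0, a)`, `(1, -a)` and shift `(2n, -n, 0)`, the angle shift `θ ↦ θ - k₀/2`, and evenness of
  `γ_k`); `diagForm_eq_integral` is the case `w = 0`.
-/

noncomputable section

namespace Summit.CriticalPhenomena.Ising3DConformalLimit.Cruxes.DirectCorrelationStableTail.SelfEnergyPickInversion

open MeasureTheory Filter Topology Finset Real Literature.Probability.LatticeModels
open scoped BigOperators
open Summit.CriticalPhenomena.Ising3DConformalLimit.Theorems.EtaBoundsTransfer
  (continuous_phase continuous_fourier_q abs_fourier_q_le_one integrableOn_cube_of_continuous
    volume_cube_lt_top)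

variable {q : Site 3 → ℝ} {P : ℕ → Site 3 → ℝ}

/-! ### A periodic shift of interval integrals -/

/-- For a `2π`-periodic `F`, `∫_{-π}^{π} F(θ) dθ = ∫_{-π}^{π} F(θ + c) dθ`. [folklore] -/
theorem intervalIntegral_eq_of_periodic_shift {F : ℝ → ℝ} (hF : Function.Periodic F (2 * π)) (c : ℝ) :
    ∫ θ in (-π)..π, F θ = ∫ θ in (-π)..π, F (θ + c) := by
  rw [intervalIntegral.integral_comp_add_right]
  have h1 := hF.intervalIntegral_add_eq (-π) (-π + c)
  rw [show -π + 2 * π = π by ring, show -π + c + 2 * π = π + c by ring] at h1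
  exact h1

/-! ### Integrability of the zeroth line transform over the transverse zone -/

/-- **The zeroth line transform is integrable over `[-π,π]²`**, and equals the slice integral of the
sheared Green symbol function. [folklore] -/
theorem integrableOn_lineTransform_zero (hq0 : ∀ y, 0 ≤ q y) (hqs : Summable q) (hq1 : ∑' y, q y ≤ 1)
    (hqev : ∀ y, q (-y) = q y) (hP0 : ∀ z, P 0 z = if z = 0 then 1 else 0)
    (hPs : ∀ j z, P (j + 1) z = ∑' y, q y * P j (z - y))
    {G : Site 3 → ℝ} (hGreen : ∀ z, HasSum (fun j => P j z) (G z)) :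
    IntegrableOn (fun k : Fin 2 → ℝ => ∫ θ in (-π)..π, (1 - ∑' x : Site 3,
      q x * Real.cos (phase 3 ![θ + k 0 / 2, θ - k 0 / 2, k 1] x))⁻¹)
      (Set.pi Set.univ (fun _ : Fin 2 => Set.Icc (-π) π)) volume := by
  obtain ⟨hq0', hqs', hq1', hqev', hP0', hPs', hGreen'⟩ := shear_stepLaw hq0 hqs hq1 hqev hP0 hPs hGreen
  have h := (green_form_eq_slab_integral hq0' hqs' hq1' hqev' hP0' hPs' hGreen' 0 {0} (fun _ => 1) 0).1
  refine h.congr_fun (fun k _ => ?_) (MeasurableSet.univ_pi fun _ => measurableSet_Icc)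
  simp only [Finset.sum_singleton, sub_self, one_mul, symbol_shear]
  have hphase0 : ∀ θ : ℝ, phase 3 (Fin.insertNth 0 θ k : Fin 3 → ℝ) 0 = 0 := fun θ => by simp [phase]
  simp only [hphase0, Real.cos_zero, one_mul, mul_one]
  have hper := lineFun_periodic q k
  rw [intervalIntegral_eq_of_periodic_shift hper (-(k 0 / 2))]
  refine intervalIntegral.integral_congr fun θ _ => ?_
  have hv : (![θ + -(k 0 / 2) + k 0 / 2, θ + -(k 0 / 2) - k 0 / 2, k 1] : Fin 3 → ℝ) = ![θ, θ - k 0, k 1] := by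
    ext j; fin_cases j <;> simp; ring
  simp only [hv]

/-! ### The two-slab Green forms along the diagonal -/

/-- **Almost every transverse momentum is good**: `k ∉ (2πℤ)²` for a.e. `k ∈ [-π,π]²`. [folklore] -/
theorem ae_good_momentum : ∀ᵐ k ∂(volume.restrict (Set.pi Set.univ (fun _ : Fin 2 => Set.Icc (-π) π))),
    ∃ j, ∀ z : ℤ, (k : Fin 2 → ℝ) j ≠ z * (2 * π) := by
  refine ae_restrict_of_ae ?_
  have hcount : ({k : Fin 2 → ℝ | ¬ ∃ j, ∀ z : ℤ, k j ≠ z * (2 * π)}).Countable := by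
    have : {k : Fin 2 → ℝ | ¬ ∃ j, ∀ z : ℤ, k j ≠ z * (2 * π)} ⊆
        Set.range (fun z : Fin 2 → ℤ => fun j => (z j : ℝ) * (2 * π)) := by
      intro k hk
      simp only [Set.mem_setOf_eq, not_exists, not_forall, not_not] at hk
      choose z hz using hk
      exact ⟨z, funext fun j => (hz j).symm⟩
    exact (Set.countable_range _).mono this
  rw [ae_iff]
  exact hcount.measure_zero volume

/-- **Integrability of the line transforms over the transverse zone**: for a continuous weight
`|w| ≤ 1`, `k ↦ ∫_{-π}^{π} w(θ) γ_k(θ) dθ` is integrable over `[-π,π]²` (dominated by the zeroth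
transform at every good momentum). [folklore] -/
theorem integrableOn_lineTransform (hq0 : ∀ y, 0 ≤ q y) (hqs : Summable q) (hq1 : ∑' y, q y ≤ 1)
    (hqev : ∀ y, q (-y) = q y) (hP0 : ∀ z, P 0 z = if z = 0 then 1 else 0)
    (hPs : ∀ j z, P (j + 1) z = ∑' y, q y * P j (z - y))
    {G : Site 3 → ℝ} (hGreen : ∀ z, HasSum (fun j => P j z) (G z)) (hGpos : ∀ m : Fin 3, 0 < G (Pi.single m 1))
    {w : ℝ → ℝ} (hw : Continuous w) (hw1 : ∀ θ, |w θ| ≤ 1) :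
    IntegrableOn (fun k : Fin 2 → ℝ => ∫ θ in (-π)..π, w θ * (1 - ∑' x : Site 3,
      q x * Real.cos (phase 3 ![θ + k 0 / 2, θ - k 0 / 2, k 1] x))⁻¹)
      (Set.pi Set.univ (fun _ : Fin 2 => Set.Icc (-π) π)) volume := by
  refine Integrable.mono' (integrableOn_lineTransform_zero hq0 hqs hq1 hqev hP0 hPs hGreen)
    (measurable_lineTransform hqs hw).aestronglyMeasurable ?_
  filter_upwards [ae_good_momentum] with k hk
  obtain ⟨hpos, hγc⟩ := lineFun_pos_continuous hq0 hqs hq1 hP0 hPs hGreen hGpos hk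
  rw [Real.norm_eq_abs]
  exact abs_lineTransform_le hγc (fun θ => (inv_pos.2 (hpos θ)).le) hw hw1

/-- The cross weight integral: `∫ cos(2nθ) cos(θ + α) γ(θ) dθ = cos α ∫ cos(2nθ) cos θ γ(θ) dθ` for an
even continuous `γ`. [folklore] -/
theorem integral_cos_mul_cos_add_mul {γ : ℝ → ℝ} (hγ : Continuous γ) (heven : ∀ θ, γ (-θ) = γ θ)
    (n : ℕ) (α : ℝ) :
    ∫ θ in (-π)..π, Real.cos (2 * n * θ) * Real.cos (θ + α) * γ θ =
      Real.cos α * ∫ θ in (-π)..π, Real.cos (2 * n * θ) * Real.cos θ * γ θ := by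
  have hexp : ∀ θ, Real.cos (2 * n * θ) * Real.cos (θ + α) * γ θ =
      Real.cos α * (Real.cos (2 * n * θ) * Real.cos θ * γ θ) -
        Real.sin α * ((Real.cos (2 * n * θ) * γ θ) * Real.sin (1 * θ)) := by
    intro θ; rw [Real.cos_add, one_mul]; ring
  simp_rw [hexp]
  have hev' : ∀ θ, (fun θ => Real.cos (2 * n * θ) * γ θ) (-θ) = (fun θ => Real.cos (2 * n * θ) * γ θ) θ :=
    fun θ => by simp only [mul_neg, Real.cos_neg, heven]
  have h0 := integral_even_mul_sin (g := fun θ => Real.cos (2 * n * θ) * γ θ) hev' 1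
  rw [intervalIntegral.integral_sub, intervalIntegral.integral_const_mul, intervalIntegral.integral_const_mul, h0]
  · ring
  · exact ((by fun_prop : Continuous fun θ => Real.cos (2 * n * θ) * Real.cos θ * γ θ).intervalIntegrable _ _).const_mul _
  · exact ((by fun_prop : Continuous fun θ => Real.cos (2 * n * θ) * γ θ * Real.sin (1 * θ)).intervalIntegrable _ _).const_mul _

/-- **The two-slab Green forms along the diagonal, as integrals of the line transforms.** Let `q` be
an even sub-stochastic step law on `ℤ³`, invariant under `x ↦ (x₁, x₀, -x₂)`, with Green function `G`
positive at the unit vectors. For a finite `s ⊂ ℤ²` (parametrising the diagonal plane by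
`a ↦ x_a = (a₀, -a₀, a₁)`), weights `v` (placed at `x_a`) and `w` (placed at `e₀ - x_a`, on the first
odd layer) and `n : ℕ`, `(2π)³` times
`∑ (v_a v_b + w_a w_b) G(x_a - x_b + n(e₀+e₁)) + ∑ w_a v_b G((e₀ - x_a) - x_b + n(e₀+e₁))
  + ∑ v_a w_b G(x_a - (e₀ - x_b) + n(e₀+e₁))`
equals `∫_{[-π,π]²} [c_{2n}(k) ∑ (v_a v_b + w_a w_b) cos(k·(a-b))
  + ẽ_n(k) ∑ (w_a v_b + v_a w_b) cos(k₀/2 - k·(a+b))] dk`, with the line transforms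
`c_{2n}(k) = ∫ cos(2nθ) γ_k`, `ẽ_n(k) = ∫ cos(2nθ) cos θ γ_k` of `γ_k(θ) = g(θ + k₀/2, θ - k₀/2, k₁)`
(Green forms as slab integrals for the sheared law `q ∘ σ`, sites `(0, a)` and `(1, -a)`, shift
`(2n, -n, 0)`; the angle shift `θ ↦ θ - k₀/2`; evenness of `γ_k` kills the sine terms). [folklore] -/
theorem twoSlab_form_eq_integral (hq0 : ∀ y, 0 ≤ q y) (hqs : Summable q) (hq1 : ∑' y, q y ≤ 1)
    (hqev : ∀ y, q (-y) = q y) (hqsym : ∀ x : Site 3, q ![x 1, x 0, -(x 2)] = q x)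
    (hP0 : ∀ z, P 0 z = if z = 0 then 1 else 0) (hPs : ∀ j z, P (j + 1) z = ∑' y, q y * P j (z - y))
    {G : Site 3 → ℝ} (hGreen : ∀ z, HasSum (fun j => P j z) (G z)) (hGpos : ∀ m : Fin 3, 0 < G (Pi.single m 1))
    (s : Finset (Fin 2 → ℤ)) (v w : (Fin 2 → ℤ) → ℝ) (n : ℕ) :
    (2 * π) ^ 3 * (∑ a ∈ s, ∑ b ∈ s, (v a * v b + w a * w b) * G ![(a 0 - b 0) + n, -(a 0 - b 0) + n, a 1 - b 1] +
      ∑ a ∈ s, ∑ b ∈ s, w a * v b * G ![n + 1 - a 0 - b 0, n + a 0 + b 0, -(a 1) - b 1] +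
      ∑ a ∈ s, ∑ b ∈ s, v a * w b * G ![n - 1 + a 0 + b 0, n - a 0 - b 0, a 1 + b 1]) =
    ∫ k in Set.pi Set.univ (fun _ : Fin 2 => Set.Icc (-π) π),
      ((∫ θ in (-π)..π, Real.cos (2 * n * θ) * (1 - ∑' x : Site 3,
          q x * Real.cos (phase 3 ![θ + k 0 / 2, θ - k 0 / 2, k 1] x))⁻¹) *
        ∑ a ∈ s, ∑ b ∈ s, (v a * v b + w a * w b) * Real.cos (phase 2 k (a - b)) +
      (∫ θ in (-π)..π, Real.cos (2 * n * θ) * Real.cos θ * (1 - ∑' x : Site 3,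
          q x * Real.cos (phase 3 ![θ + k 0 / 2, θ - k 0 / 2, k 1] x))⁻¹) *
        ∑ a ∈ s, ∑ b ∈ s, (w a * v b + v a * w b) * Real.cos (k 0 / 2 - phase 2 k (a + b))) := by
  have hπ := Real.pi_pos
  obtain ⟨hq0', hqs', hq1', hqev', hP0', hPs', hGreen'⟩ := shear_stepLaw hq0 hqs hq1 hqev hP0 hPs hGreen
  -- the two-slab site set and weights
  set ι₀ : (Fin 2 → ℤ) → Site 3 := fun a => ![0, a 0, a 1] with hι₀
  set ι₁ : (Fin 2 → ℤ) → Site 3 := fun a => ![1, -(a 0), -(a 1)] with hι₁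
  have hι₀inj : Function.Injective ι₀ := by
    intro a b h
    have h1 := congrFun h 1; have h2 := congrFun h 2
    simp [hι₀] at h1 h2
    ext j; fin_cases j <;> assumption
  have hι₁inj : Function.Injective ι₁ := by
    intro a b h
    have h1 := congrFun h 1; have h2 := congrFun h 2
    simp [hι₁] at h1 h2
    ext j; fin_cases j <;> assumption
  have hdisj : Disjoint (s.image ι₀) (s.image ι₁) := by
    rw [Finset.disjoint_left]
    intro z hz0 hz1
    obtain ⟨a, -, rfl⟩ := Finset.mem_image.1 hz0
    obtain ⟨b, -, hb⟩ := Finset.mem_image.1 hz1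
    have := congrFun hb 0
    simp [hι₀, hι₁] at this
  set S : Finset (Site 3) := s.image ι₀ ∪ s.image ι₁ with hS
  set V : Site 3 → ℝ := fun z => if z 0 = 0 then v ![z 1, z 2] else w ![-(z 1), -(z 2)] with hV
  have hV0 : ∀ a, V (ι₀ a) = v a := fun a => by
    simp only [hV, hι₀]; simp; congr 1; ext j; fin_cases j <;> rfl
  have hV1 : ∀ a, V (ι₁ a) = w a := fun a => by
    simp only [hV, hι₁]; simp; congr 1; ext j; fin_cases j <;> simp
  set U : Site 3 := ![2 * n, -n, 0] with hU
  -- a double sum over `S` splits into four blocks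
  have hsplit : ∀ f : Site 3 → Site 3 → ℝ, ∑ z ∈ S, ∑ z' ∈ S, V z * V z' * f z z' =
      ∑ a ∈ s, ∑ b ∈ s, v a * v b * f (ι₀ a) (ι₀ b) + ∑ a ∈ s, ∑ b ∈ s, w a * w b * f (ι₁ a) (ι₁ b) +
      ∑ a ∈ s, ∑ b ∈ s, w a * v b * f (ι₁ a) (ι₀ b) + ∑ a ∈ s, ∑ b ∈ s, v a * w b * f (ι₀ a) (ι₁ b) := by
    intro f
    rw [hS, Finset.sum_union hdisj, Finset.sum_image hι₀inj.injOn, Finset.sum_image hι₁inj.injOn]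
    have h1 : ∀ a, ∑ z' ∈ s.image ι₀ ∪ s.image ι₁, V (ι₀ a) * V z' * f (ι₀ a) z' =
        ∑ b ∈ s, v a * v b * f (ι₀ a) (ι₀ b) + ∑ b ∈ s, v a * w b * f (ι₀ a) (ι₁ b) := by
      intro a
      rw [Finset.sum_union hdisj, Finset.sum_image hι₀inj.injOn, Finset.sum_image hι₁inj.injOn]
      simp only [hV0, hV1]
    have h2 : ∀ a, ∑ z' ∈ s.image ι₀ ∪ s.image ι₁, V (ι₁ a) * V z' * f (ι₁ a) z' =
        ∑ b ∈ s, w a * v b * f (ι₁ a) (ι₀ b) + ∑ b ∈ s, w a * w b * f (ι₁ a) (ι₁ b) := by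
      intro a
      rw [Finset.sum_union hdisj, Finset.sum_image hι₀inj.injOn, Finset.sum_image hι₁inj.injOn]
      simp only [hV0, hV1]
    simp_rw [h1, h2, Finset.sum_add_distrib]
    ring
  -- the Green-form / slab identity for the sheared law
  have key := (green_form_eq_slab_integral hq0' hqs' hq1' hqev' hP0' hPs' hGreen' 0 S V U).2
  -- LEFT-HAND SIDE: the four blocks
  have hL00 : ∀ a b, G ![(ι₀ a - ι₀ b + U) 0 + (ι₀ a - ι₀ b + U) 1, -((ι₀ a - ι₀ b + U) 1), (ι₀ a - ι₀ b + U) 2] =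
      G ![(a 0 - b 0) + n, -(a 0 - b 0) + n, a 1 - b 1] := fun a b => by
    congr 1; ext j; fin_cases j <;> simp [hι₀, hU] <;> ring
  have hL11 : ∀ a b, G ![(ι₁ a - ι₁ b + U) 0 + (ι₁ a - ι₁ b + U) 1, -((ι₁ a - ι₁ b + U) 1), (ι₁ a - ι₁ b + U) 2] =
      G ![(b 0 - a 0) + n, -(b 0 - a 0) + n, b 1 - a 1] := fun a b => by
    congr 1; ext j; fin_cases j <;> simp [hι₁, hU] <;> ring
  have hL10 : ∀ a b, G ![(ι₁ a - ι₀ b + U) 0 + (ι₁ a - ι₀ b + U) 1, -((ι₁ a - ι₀ b + U) 1), (ι₁ a - ι₀ b + U) 2] =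
      G ![n + 1 - a 0 - b 0, n + a 0 + b 0, -(a 1) - b 1] := fun a b => by
    congr 1; ext j; fin_cases j <;> simp [hι₀, hι₁, hU] <;> ring
  have hL01 : ∀ a b, G ![(ι₀ a - ι₁ b + U) 0 + (ι₀ a - ι₁ b + U) 1, -((ι₀ a - ι₁ b + U) 1), (ι₀ a - ι₁ b + U) 2] =
      G ![n - 1 + a 0 + b 0, n - a 0 - b 0, a 1 + b 1] := fun a b => by
    congr 1; ext j; fin_cases j <;> simp [hι₀, hι₁, hU] <;> ring
  have hLHS : ∑ z ∈ S, ∑ z' ∈ S, V z * V z' *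
      G ![(z - z' + U) 0 + (z - z' + U) 1, -((z - z' + U) 1), (z - z' + U) 2] =
      ∑ a ∈ s, ∑ b ∈ s, (v a * v b + w a * w b) * G ![(a 0 - b 0) + n, -(a 0 - b 0) + n, a 1 - b 1] +
      ∑ a ∈ s, ∑ b ∈ s, w a * v b * G ![n + 1 - a 0 - b 0, n + a 0 + b 0, -(a 1) - b 1] +
      ∑ a ∈ s, ∑ b ∈ s, v a * w b * G ![n - 1 + a 0 + b 0, n - a 0 - b 0, a 1 + b 1] := by
    rw [hsplit (fun z z' => G ![(z - z' + U) 0 + (z - z' + U) 1, -((z - z' + U) 1), (z - z' + U) 2])]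
    simp only [hL00, hL11, hL10, hL01]
    have hsw : ∑ a ∈ s, ∑ b ∈ s, w a * w b * G ![(b 0 - a 0) + n, -(b 0 - a 0) + n, b 1 - a 1] =
        ∑ a ∈ s, ∑ b ∈ s, w a * w b * G ![(a 0 - b 0) + n, -(a 0 - b 0) + n, a 1 - b 1] := by
      rw [Finset.sum_comm]
      exact Finset.sum_congr rfl fun a _ => Finset.sum_congr rfl fun b _ => by ring
    rw [hsw]
    simp_rw [add_mul, Finset.sum_add_distrib]
  rw [hLHS] at key
  rw [key]
  -- RIGHT-HAND SIDE: the slice integrals, at almost every (every good) transverse momentum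
  refine integral_congr_ae ?_
  filter_upwards [ae_good_momentum] with k hk
  set γ : ℝ → ℝ := fun θ => (1 - ∑' x : Site 3, q x * Real.cos (phase 3 ![θ + k 0 / 2, θ - k 0 / 2, k 1] x))⁻¹
    with hγ
  -- the symbol of the sheared law on the slab circle
  have hsymb : ∀ θ : ℝ, (1 - ∑' y : Site 3, q ![y 0 + y 1, -(y 1), y 2] *
      Real.cos (phase 3 (Fin.insertNth 0 θ k : Fin 3 → ℝ) y))⁻¹ = γ (θ + -(k 0 / 2)) := by
    intro θ
    rw [symbol_shear]
    have hv : (![θ + -(k 0 / 2) + k 0 / 2, θ + -(k 0 / 2) - k 0 / 2, k 1] : Fin 3 → ℝ) = ![θ, θ - k 0, k 1] := by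
      ext j; fin_cases j <;> simp; ring
    simp only [hγ, hv]
  -- the phases on the slab circle
  have hphU : ∀ θ : ℝ, phase 3 (Fin.insertNth 0 θ k : Fin 3 → ℝ) U = 2 * n * (θ + -(k 0 / 2)) := fun θ => by
    rw [insertNth_zero_eq_vec3, phase_vec3]; simp [hU]; ring
  have hph00 : ∀ (θ : ℝ) a b, phase 3 (Fin.insertNth 0 θ k : Fin 3 → ℝ) (ι₀ a - ι₀ b) = phase 2 k (a - b) := by
    intro θ a b; rw [insertNth_zero_eq_vec3, phase_vec3]; simp [hι₀, phase, Fin.sum_univ_two]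
  have hph11 : ∀ (θ : ℝ) a b, Real.cos (phase 3 (Fin.insertNth 0 θ k : Fin 3 → ℝ) (ι₁ a - ι₁ b)) =
      Real.cos (phase 2 k (a - b)) := by
    intro θ a b; rw [insertNth_zero_eq_vec3, phase_vec3, ← Real.cos_neg]
    congr 1; simp [hι₁, phase, Fin.sum_univ_two]; ring
  have hph10 : ∀ (θ : ℝ) a b, Real.cos (phase 3 (Fin.insertNth 0 θ k : Fin 3 → ℝ) (ι₁ a - ι₀ b)) =
      Real.cos ((θ + -(k 0 / 2)) + (k 0 / 2 - phase 2 k (a + b))) := by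
    intro θ a b; rw [insertNth_zero_eq_vec3, phase_vec3]
    congr 1; simp [hι₀, hι₁, phase, Fin.sum_univ_two]; ring
  have hph01 : ∀ (θ : ℝ) a b, Real.cos (phase 3 (Fin.insertNth 0 θ k : Fin 3 → ℝ) (ι₀ a - ι₁ b)) =
      Real.cos ((θ + -(k 0 / 2)) + (k 0 / 2 - phase 2 k (a + b))) := by
    intro θ a b; rw [insertNth_zero_eq_vec3, phase_vec3, ← Real.cos_neg]
    congr 1; simp [hι₀, hι₁, phase, Fin.sum_univ_two]; ring
  -- the weight on the slab circle
  set Wev : ℝ := ∑ a ∈ s, ∑ b ∈ s, (v a * v b + w a * w b) * Real.cos (phase 2 k (a - b)) with hWev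
  set Cr : ℝ → ℝ := fun θ' => ∑ a ∈ s, ∑ b ∈ s, (w a * v b + v a * w b) *
    Real.cos (θ' + (k 0 / 2 - phase 2 k (a + b))) with hCr
  have hW : ∀ θ : ℝ, ∑ z ∈ S, ∑ z' ∈ S, V z * V z' * Real.cos (phase 3 (Fin.insertNth 0 θ k : Fin 3 → ℝ) (z - z')) =
      Wev + Cr (θ + -(k 0 / 2)) := by
    intro θ
    rw [hsplit (fun z z' => Real.cos (phase 3 (Fin.insertNth 0 θ k : Fin 3 → ℝ) (z - z')))]
    simp only [hph00, hph11, hph10, hph01, hWev, hCr]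
    simp_rw [add_mul, Finset.sum_add_distrib]
    ring
  -- shift the angle
  have hinner : ∀ θ : ℝ, Real.cos (phase 3 (Fin.insertNth 0 θ k : Fin 3 → ℝ) U) *
      (1 - ∑' y : Site 3, q ![y 0 + y 1, -(y 1), y 2] * Real.cos (phase 3 (Fin.insertNth 0 θ k : Fin 3 → ℝ) y))⁻¹ *
      ∑ z ∈ S, ∑ z' ∈ S, V z * V z' * Real.cos (phase 3 (Fin.insertNth 0 θ k : Fin 3 → ℝ) (z - z')) =
      (fun θ' => Real.cos (2 * n * θ') * γ θ' * (Wev + Cr θ')) (θ + -(k 0 / 2)) := fun θ => by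
    rw [hphU, hsymb, hW]
  simp_rw [hinner]
  have hγper : Function.Periodic γ (2 * π) := lineFun_periodic q k
  have hFper : Function.Periodic (fun θ' => Real.cos (2 * n * θ') * γ θ' * (Wev + Cr θ')) (2 * π) := by
    intro θ'
    simp only
    rw [hγper]
    congr 2
    · rw [show 2 * (n : ℝ) * (θ' + 2 * π) = 2 * n * θ' + ((2 * n : ℕ) : ℤ) * (2 * π) by push_cast; ring,
        Real.cos_add_int_mul_two_pi]
    · simp only [hCr]
      refine Finset.sum_congr rfl fun a _ => Finset.sum_congr rfl fun b _ => ?_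
      rw [show θ' + 2 * π + (k 0 / 2 - phase 2 k (a + b)) = (θ' + (k 0 / 2 - phase 2 k (a + b))) + (1 : ℤ) * (2 * π)
        by push_cast; ring, Real.cos_add_int_mul_two_pi]
  rw [← intervalIntegral_eq_of_periodic_shift hFper]
  -- at a good momentum `γ` is continuous and even: integrate termwise
  · obtain ⟨hpos, hγc⟩ := lineFun_pos_continuous hq0 hqs hq1 hP0 hPs hGreen hGpos hk
    have hγc' : Continuous γ := hγc
    have hγev : ∀ θ, γ (-θ) = γ θ := fun θ => lineFun_neg hqev hqsym k θ
    have hCrc : Continuous Cr := by simp only [hCr]; fun_prop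
    have hexp : ∀ θ', Real.cos (2 * n * θ') * γ θ' * (Wev + Cr θ') =
        Wev * (Real.cos (2 * n * θ') * γ θ') + ∑ a ∈ s, ∑ b ∈ s, (w a * v b + v a * w b) *
          (Real.cos (2 * n * θ') * Real.cos (θ' + (k 0 / 2 - phase 2 k (a + b))) * γ θ') := by
      intro θ'
      have h1 : Real.cos (2 * n * θ') * γ θ' * Cr θ' = ∑ a ∈ s, ∑ b ∈ s, (w a * v b + v a * w b) *
          (Real.cos (2 * n * θ') * Real.cos (θ' + (k 0 / 2 - phase 2 k (a + b))) * γ θ') := by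
        simp only [hCr, Finset.mul_sum]
        exact Finset.sum_congr rfl fun a _ => Finset.sum_congr rfl fun b _ => by ring
      rw [mul_add, h1]; ring
    simp_rw [hexp]
    have hi1 : IntervalIntegrable (fun θ' => Wev * (Real.cos (2 * n * θ') * γ θ')) volume (-π) π :=
      ((by fun_prop : Continuous fun θ' => Wev * (Real.cos (2 * n * θ') * γ θ')).intervalIntegrable _ _)
    have hi2 : ∀ a b, IntervalIntegrable (fun θ' => (w a * v b + v a * w b) *
        (Real.cos (2 * n * θ') * Real.cos (θ' + (k 0 / 2 - phase 2 k (a + b))) * γ θ')) volume (-π) π :=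
      fun a b => ((by fun_prop : Continuous fun θ' => (w a * v b + v a * w b) *
        (Real.cos (2 * n * θ') * Real.cos (θ' + (k 0 / 2 - phase 2 k (a + b))) * γ θ')).intervalIntegrable _ _)
    have hi3 : IntervalIntegrable (fun θ' => ∑ a ∈ s, ∑ b ∈ s, (w a * v b + v a * w b) *
        (Real.cos (2 * n * θ') * Real.cos (θ' + (k 0 / 2 - phase 2 k (a + b))) * γ θ')) volume (-π) π :=
      ((by fun_prop : Continuous fun θ' => ∑ a ∈ s, ∑ b ∈ s, (w a * v b + v a * w b) *
        (Real.cos (2 * n * θ') * Real.cos (θ' + (k 0 / 2 - phase 2 k (a + b))) * γ θ')).intervalIntegrable _ _)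
    have hi4 : ∀ a, IntervalIntegrable (fun θ' => ∑ b ∈ s, (w a * v b + v a * w b) *
        (Real.cos (2 * n * θ') * Real.cos (θ' + (k 0 / 2 - phase 2 k (a + b))) * γ θ')) volume (-π) π :=
      fun a => ((by fun_prop : Continuous fun θ' => ∑ b ∈ s, (w a * v b + v a * w b) *
        (Real.cos (2 * n * θ') * Real.cos (θ' + (k 0 / 2 - phase 2 k (a + b))) * γ θ')).intervalIntegrable _ _)
    rw [intervalIntegral.integral_add hi1 hi3, intervalIntegral.integral_const_mul,
      intervalIntegral.integral_finsetSum (fun a _ => hi4 a)]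
    have hin : ∀ a, ∫ θ' in (-π)..π, ∑ b ∈ s, (w a * v b + v a * w b) *
        (Real.cos (2 * n * θ') * Real.cos (θ' + (k 0 / 2 - phase 2 k (a + b))) * γ θ') =
        ∑ b ∈ s, (w a * v b + v a * w b) * (Real.cos (k 0 / 2 - phase 2 k (a + b)) *
          ∫ θ' in (-π)..π, Real.cos (2 * n * θ') * Real.cos θ' * γ θ') := by
      intro a
      rw [intervalIntegral.integral_finsetSum (fun b _ => hi2 a b)]
      refine Finset.sum_congr rfl fun b _ => ?_
      rw [intervalIntegral.integral_const_mul, integral_cos_mul_cos_add_mul hγc' hγev n]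
    simp_rw [hin]
    simp only [hγ, hWev]
    congr 1
    · ring
    · rw [Finset.mul_sum]
      refine Finset.sum_congr rfl fun a _ => ?_
      rw [Finset.mul_sum]
      exact Finset.sum_congr rfl fun b _ => by ring

/-- **The even diagonal Green forms as integrals of the even line transforms** (the case `w = 0`):
`(2π)³ ∑_{a,b∈s} v_a v_b G(x_a - x_b + n(e₀+e₁)) = ∫_{[-π,π]²} c_{2n}(k) W_v(k) dk`. [folklore] -/
theorem diagForm_eq_integral (hq0 : ∀ y, 0 ≤ q y) (hqs : Summable q) (hq1 : ∑' y, q y ≤ 1)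
    (hqev : ∀ y, q (-y) = q y) (hqsym : ∀ x : Site 3, q ![x 1, x 0, -(x 2)] = q x)
    (hP0 : ∀ z, P 0 z = if z = 0 then 1 else 0) (hPs : ∀ j z, P (j + 1) z = ∑' y, q y * P j (z - y))
    {G : Site 3 → ℝ} (hGreen : ∀ z, HasSum (fun j => P j z) (G z)) (hGpos : ∀ m : Fin 3, 0 < G (Pi.single m 1))
    (s : Finset (Fin 2 → ℤ)) (v : (Fin 2 → ℤ) → ℝ) (n : ℕ) :
    (2 * π) ^ 3 * ∑ a ∈ s, ∑ b ∈ s, v a * v b * G ![(a 0 - b 0) + n, -(a 0 - b 0) + n, a 1 - b 1] =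
    ∫ k in Set.pi Set.univ (fun _ : Fin 2 => Set.Icc (-π) π),
      (∫ θ in (-π)..π, Real.cos (2 * n * θ) * (1 - ∑' x : Site 3,
          q x * Real.cos (phase 3 ![θ + k 0 / 2, θ - k 0 / 2, k 1] x))⁻¹) *
        ∑ a ∈ s, ∑ b ∈ s, v a * v b * Real.cos (phase 2 k (a - b)) := by
  have h := twoSlab_form_eq_integral hq0 hqs hq1 hqev hqsym hP0 hPs hGreen hGpos s v (fun _ => 0) n
  simp only [zero_mul, mul_zero, add_zero, Finset.sum_const_zero] at h
  exact h

/-- **Registered auxiliary stub `stub_slabModeExpDecay_auxDiagLineHol5`** (sub-goal of the brick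
`stub_slabModeExpDecay_auxDiagLineHol` of `stub_slabModeExpDecay`): the two-slab Green forms along the
diagonal as integrals of the diagonal line transforms (`twoSlab_form_eq_integral`). [folklore] -/
theorem stub_slabModeExpDecay_auxDiagLineHol5 : ∀ (q : Site 3 → ℝ) (P : ℕ → Site 3 → ℝ) (G : Site 3 → ℝ), (∀ y, 0 ≤ q y) → Summable q → ∑' y, q y ≤ 1 → (∀ y, q (-y) = q y) → (∀ x : Site 3, q ![x 1, x 0, -(x 2)] = q x) → (∀ z, P 0 z = if z = 0 then 1 else 0) → (∀ j z, P (j + 1) z = ∑' y, q y * P j (z - y)) → (∀ z, HasSum (fun j => P j z) (G z)) → (∀ m : Fin 3, 0 < G (Pi.single m 1)) → ∀ (s : Finset (Fin 2 → ℤ)) (v w : (Fin 2 → ℤ) → ℝ) (n : ℕ), (2 * Real.pi) ^ 3 * (∑ a ∈ s, ∑ b ∈ s, (v a * v b + w a * w b) * G ![(a 0 - b 0) + n, -(a 0 - b 0) + n, a 1 - b 1] + ∑ a ∈ s, ∑ b ∈ s, w a * v b * G ![n + 1 - a 0 - b 0, n + a 0 + b 0, -(a 1) - b 1] + ∑ a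 ∈ s, ∑ b ∈ s, v a * w b * G ![n - 1 + a 0 + b 0, n - a 0 - b 0, a 1 + b 1]) = ∫ k in Set.pi Set.univ (fun _ : Fin 2 => Set.Icc (-Real.pi) Real.pi), ((∫ θ in (-Real.pi)..Real.pi, Real.cos (2 * n * θ) * (1 - ∑' x : Site 3, q x * Real.cos (phase 3 ![θ + k 0 / 2, θ - k 0 / 2, k 1] x))⁻¹) * ∑ a ∈ s, ∑ b ∈ s, (v a * v b + w a * w b) * Real.cos (phase 2 k (a - b)) + (∫ θ in (-Real.pi)..Real.pi, Real.cos (2 * n * θ) * Real.cos θ * (1 - ∑' x : Site 3, q x * Real.cos (phase 3 ![θ + k 0 / 2, θ - k 0 / 2, k 1] x))⁻¹) * ∑ a ∈ s, ∑ b ∈ s, (w a * v b + v a * w b) * Real.cos (k 0 / 2 - phase 2 k (a + b))) :=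
  fun _ _ _ hq0 hqs hq1 hqev hqsym hP0 hPs hGreen hGpos s v w n =>
    twoSlab_form_eq_integral hq0 hqs hq1 hqev hqsym hP0 hPs hGreen hGpos s v w n

end Summit.CriticalPhenomena.Ising3DConformalLimit.Cruxes.DirectCorrelationStableTail.SelfEnergyPickInversion

end
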